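import Summits.Schanuel.Schanuel.Theorems.ZilberEacNearResonantLabels
import Mathlib.Analysis.Calculus.ImplicitFunction.ProdDomain
import Mathlib.Analysis.Calculus.ContDiff.RCLike
import Mathlib.Analysis.SpecialFunctions.ExpDeriv
import Mathlib.Topology.Algebra.Module.FiniteDimension
import Mathlib.Analysis.SpecialFunctions.Complex.Log
import HarnessLib

/-!
# The critical size along DIAGONAL lattice rays: implicit-function continuation of the
# NONLINEAR limit system (every hyperplane constant)

Zilber's Exponential-Algebraic Closedness, case ladder (host summit Schanuel, cell `pub-schanuel`,
seat 2, gen 13).  THE CRITICAL-SIZE FAMILY with an arbitrary constant: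

  `W_{r,c} = {x₂ = r₀x₀ + (1 - r₀)x₁ + c, y₀ = x₀ + y₂, y₁ = x₁ + y₂}`,  `r₀ ∈ ℝ`, `c ∈ ℂ`,

exponential points `e^{xⱼ} = xⱼ + e^{x₂}`.  Along the DIAGONAL rays `x = (2πi p m + log m)(1,1) + ρ`
(`p ∈ ℤ ∖ 0`) the phase of `e^{x₂}` is `e^{2πipm(r₀+r₁)} = 1` and `|e^{x₂}| ≍ m ≍ |xⱼ|` (critical),
and the rescaled system in `ρ = (ρ₀, ρ₁)` with parameters `s = 1/m`, `ℓ = log m/m`,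

  `e^{ρⱼ} = 2πip + e^{c + r₀ρ₀ + r₁ρ₁} + ℓ + s ρⱼ`   (`j = 0, 1`),

is ENTIRE; at `s = ℓ = 0` it is the genuinely nonlinear limit system recorded as the obstacle in
O54 (a) — but on the diagonal it is EXPLICITLY SOLVABLE: `e^{ρ₀} = e^{ρ₁} = E`,
`E(1 - e^{c}ζ^k) = 2πip` with `ρ₁ = ρ₀ + 2πik`, `ζ = e^{2πir₁}`; and its Jacobian there has
determinant `E(E - G) = 2πip·E ≠ 0` (`G = e^{c + r·ρ} = E - 2πip`).

* `exists_implicit_of_injective_partial` — a generic wrapper of Mathlib's implicit function theorem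
  on a product domain (finite-dimensional unknowns: injective partial derivative suffices);
* **`exists_solutions_diagonalCritical`** — for every base solution `(ρ₀*, ρ₁*)` of the limit
  system there are solutions `x(m) = (2πipm + log m)(1,1) + ρ(m)` of `e^{xⱼ} = xⱼ + e^{r·x + c}`
  for all large `m`, with `ρ(m) → ρ*`.

Density (via a bounded/linear/linear elimination and the genericity of the limit family over the
labels `k`) is assembled in `ZilberEacDiagonalCriticalDensity`.

HONEST FRAMING: an existence theorem for explicit members of an OPEN cell (`ECCell 3 2`);
NOT Schanuel's conjecture; EAC ⇏ SC.
-/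

noncomputable section

open Complex Filter Topology

set_option linter.dupNamespace false

namespace Summit.Schanuel.Schanuel.Theorems

/-! ## Part A. Implicit-function continuation, generic form -/

section IFT

/-- **Implicit-function continuation (finite-dimensional unknowns).**  `f : E₁ × E₂ → E₂` of class
`C¹`, `f(p, q) = 0`, and the partial derivative `L` of `f(p, ·)` at `q` injective: there is a
solution map `ψ` near `p` with `f(p', ψ p') = 0` and `ψ p' → q` (`p' → p`).  Mathlib's
`HasStrictFDerivAt.implicitFunctionOfProdDomain`. [folklore] -/
theorem exists_implicit_of_injective_partial {E₁ E₂ : Type*}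
    [NormedAddCommGroup E₁] [NormedSpace ℂ E₁] [CompleteSpace E₁]
    [NormedAddCommGroup E₂] [NormedSpace ℂ E₂] [CompleteSpace E₂] [FiniteDimensional ℂ E₂]
    {f : E₁ × E₂ → E₂} (hf : ContDiff ℂ 1 f) {p : E₁} {q : E₂} (hq : f (p, q) = 0)
    {L : E₂ →L[ℂ] E₂} (hL : HasFDerivAt (fun q' => f (p, q')) L q)
    (hinj : Function.Injective L) :
    ∃ ψ : E₁ → E₂, (∀ᶠ p' in 𝓝 p, f (p', ψ p') = 0) ∧ Tendsto ψ (𝓝 p) (𝓝 q) := by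
  have hcd : ContDiffAt ℂ 1 f (p, q) := hf.contDiffAt
  have hstrict := hcd.hasStrictFDerivAt one_ne_zero
  have hpart : HasFDerivAt (fun q' => f (p, q'))
      ((fderiv ℂ f (p, q)).comp (ContinuousLinearMap.inr ℂ E₁ E₂)) q :=
    hstrict.hasFDerivAt.comp q (hasFDerivAt_prodMk_right (𝕜 := ℂ) p q)
  have hLeq := hpart.unique hL
  have hinv : ((fderiv ℂ f (p, q)).comp (ContinuousLinearMap.inr ℂ E₁ E₂)).IsInvertible := by
    rw [hLeq]
    have hsurj : Function.Surjective (L : E₂ →ₗ[ℂ] E₂) :=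
      LinearMap.injective_iff_surjective.1 hinj
    let e : E₂ ≃ₗ[ℂ] E₂ := LinearEquiv.ofBijective (L : E₂ →ₗ[ℂ] E₂) ⟨hinj, hsurj⟩
    exact ⟨e.toContinuousLinearEquiv, ContinuousLinearMap.ext fun w => rfl⟩
  refine ⟨hstrict.implicitFunctionOfProdDomain hinv, ?_,
    hstrict.tendsto_implicitFunctionOfProdDomain hinv⟩
  have h := hstrict.eventually_apply_implicitFunctionOfProdDomain hinv
  rw [hq] at h
  exact h

end IFT

/-! ## Part B. Diagonal-ray solutions at critical size -/

section Diagonal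

/-- The parameter sequence `(1/m, log m / m) → (0, 0)`. [folklore] -/
theorem tendsto_inv_and_log_div :
    Tendsto (fun m : ℕ => ((((1 / (m : ℝ) : ℝ)) : ℂ), (((Real.log m / (m : ℝ) : ℝ)) : ℂ))) atTop
      (𝓝 ((0 : ℂ), (0 : ℂ))) := by
  refine Tendsto.prodMk_nhds ?_ ?_
  · have h := (continuous_ofReal.tendsto (0 : ℝ)).comp tendsto_one_div_atTop_nhds_zero_nat
    rw [ofReal_zero] at h
    exact h
  · have h := (continuous_ofReal.tendsto (0 : ℝ)).comp
      (tendsto_log_pow_div_natCast_comp (d := fun m => m) tendsto_id 1)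
    rw [ofReal_zero] at h
    refine h.congr fun k => ?_
    simp only [Function.comp_apply, pow_one]

/-- **THEOREM (diagonal-ray solutions at critical size).**  `r₀ ∈ ℝ`, `c ∈ ℂ`, `p ∈ ℤ ∖ 0`, and a
base solution `(ρ₀*, ρ₁*)` of the limit system `e^{ρⱼ*} = 2πip + e^{c + r₀ρ₀* + (1-r₀)ρ₁*}`
(`j = 0, 1`).  Then there are `ρ(m) → ρ*` such that
`x(m) = (2πipm + log m + ρ₀(m), 2πipm + log m + ρ₁(m))` solves
`e^{xⱼ} = xⱼ + e^{r₀x₀ + (1-r₀)x₁ + c}` (`j = 0, 1`) for all large `m`. (new)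
[cite: MantovaMasser2023, §1 p.5 (the open case dim π(V) = 2 in ℂ³×ℂˣ³)] -/
theorem exists_solutions_diagonalCritical (r₀ : ℝ) (c : ℂ) {p : ℤ} (hp : p ≠ 0) {ρs : ℂ × ℂ}
    (h0 : exp ρs.1 = 2 * Real.pi * I * p + exp (c + (r₀ : ℂ) * ρs.1 + ((1 - r₀ : ℝ) : ℂ) * ρs.2))
    (h1 : exp ρs.2 = 2 * Real.pi * I * p + exp (c + (r₀ : ℂ) * ρs.1 + ((1 - r₀ : ℝ) : ℂ) * ρs.2)) :
    ∃ (x : ℕ → Fin 2 → ℂ) (ρ : ℕ → ℂ × ℂ), Tendsto ρ atTop (𝓝 ρs) ∧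
      (∀ m, x m 0 = 2 * Real.pi * I * p * m + Real.log m + (ρ m).1) ∧
      (∀ m, x m 1 = 2 * Real.pi * I * p * m + Real.log m + (ρ m).2) ∧
      (∀ᶠ m in atTop, ∀ j : Fin 2,
        exp (x m j) = x m j + exp (∑ i, ((![r₀, 1 - r₀] : Fin 2 → ℝ) i : ℂ) * x m i + c)) := by
  -- constants
  set P : ℂ := 2 * Real.pi * I * p with hP
  set r₁ : ℂ := ((1 - r₀ : ℝ) : ℂ) with hr₁
  have hP0 : P ≠ 0 := mul_ne_zero Complex.two_pi_I_ne_zero (by exact_mod_cast hp)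
  have hsum : (r₀ : ℂ) + r₁ = 1 := by rw [hr₁]; push_cast; ring
  -- the rescaled system
  set f : (ℂ × ℂ) × (ℂ × ℂ) → ℂ × ℂ := fun v =>
    (exp v.2.1 - P - exp (c + (r₀ : ℂ) * v.2.1 + r₁ * v.2.2) - v.1.2 - v.1.1 * v.2.1,
      exp v.2.2 - P - exp (c + (r₀ : ℂ) * v.2.1 + r₁ * v.2.2) - v.1.2 - v.1.1 * v.2.2) with hf
  have hfC : ContDiff ℂ 1 f := by
    rw [hf]
    fun_prop
  set G : ℂ := exp (c + (r₀ : ℂ) * ρs.1 + r₁ * ρs.2) with hG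
  have hfq : f (((0 : ℂ), (0 : ℂ)), ρs) = 0 := by
    simp only [hf, Prod.mk_eq_zero, zero_mul, sub_zero]
    constructor
    · rw [h0]; ring
    · rw [h1]; ring
  -- the partial derivative and its injectivity
  set L : (ℂ × ℂ) →L[ℂ] (ℂ × ℂ) :=
    ((exp ρs.1 - G * r₀) • ContinuousLinearMap.fst ℂ ℂ ℂ -
        (G * r₁) • ContinuousLinearMap.snd ℂ ℂ ℂ).prod
      (-(G * r₀) • ContinuousLinearMap.fst ℂ ℂ ℂ +
        (exp ρs.2 - G * r₁) • ContinuousLinearMap.snd ℂ ℂ ℂ) with hL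
  have hLderiv : HasFDerivAt (fun q' : ℂ × ℂ => f (((0 : ℂ), (0 : ℂ)), q')) L ρs := by
    have e : (fun q' : ℂ × ℂ => f (((0 : ℂ), (0 : ℂ)), q')) = fun q' =>
        (exp q'.1 - P - exp (c + (r₀ : ℂ) * q'.1 + r₁ * q'.2),
          exp q'.2 - P - exp (c + (r₀ : ℂ) * q'.1 + r₁ * q'.2)) := by
      funext q'
      simp only [hf, zero_mul, sub_zero]
    rw [e]
    have ha : HasFDerivAt (fun q' : ℂ × ℂ => q'.1) (ContinuousLinearMap.fst ℂ ℂ ℂ) ρs :=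
      hasFDerivAt_fst
    have hb : HasFDerivAt (fun q' : ℂ × ℂ => q'.2) (ContinuousLinearMap.snd ℂ ℂ ℂ) ρs :=
      hasFDerivAt_snd
    have hlin : HasFDerivAt (fun q' : ℂ × ℂ => c + (r₀ : ℂ) * q'.1 + r₁ * q'.2)
        ((r₀ : ℂ) • ContinuousLinearMap.fst ℂ ℂ ℂ + r₁ • ContinuousLinearMap.snd ℂ ℂ ℂ) ρs := by
      have := ((ha.const_mul (r₀ : ℂ)).const_add c).add (hb.const_mul r₁)
      exact this
    have c0 := (ha.cexp.sub_const P).sub hlin.cexp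
    have c1 := (hb.cexp.sub_const P).sub hlin.cexp
    refine (c0.prodMk c1).congr_fderiv ?_
    rw [hL, hG]
    ext <;> simp
  have hinj : Function.Injective L := by
    refine (injective_iff_map_eq_zero _).2 fun w hw => ?_
    have hw' : (exp ρs.1 - G * r₀) * w.1 - G * r₁ * w.2 = 0 ∧
        -(G * r₀) * w.1 + (exp ρs.2 - G * r₁) * w.2 = 0 := by
      rw [hL] at hw
      simpa [Prod.ext_iff] using hw
    obtain ⟨e0, e1⟩ := hw'
    have hE0 : exp ρs.1 = P + G := by rw [h0]
    have hE1 : exp ρs.2 = P + G := by rw [h1]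
    rw [hE0] at e0
    rw [hE1] at e1
    have hPG : P + G ≠ 0 := by rw [← hE0]; exact Complex.exp_ne_zero _
    -- `E(w₁ - w₂) = 0`, then `P w₁ = 0`
    have hdiff : (P + G) * (w.1 - w.2) = 0 := by linear_combination e0 - e1
    have hw12 : w.1 = w.2 := by
      have := (mul_eq_zero.1 hdiff).resolve_left hPG
      exact sub_eq_zero.1 this
    have hw1 : P * w.1 = 0 := by
      rw [← hw12] at e0
      linear_combination e0 + (G * w.1) * hsum
    have hw1' : w.1 = 0 := (mul_eq_zero.1 hw1).resolve_left hP0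
    exact Prod.ext hw1' (by rw [← hw12, hw1']; rfl)
  -- the implicit function and the solutions
  obtain ⟨ψ, hψsol, hψlim⟩ := exists_implicit_of_injective_partial hfC hfq hLderiv hinj
  set pr : ℕ → ℂ × ℂ := fun m => ((((1 / (m : ℝ) : ℝ)) : ℂ), (((Real.log m / (m : ℝ) : ℝ)) : ℂ))
    with hpr
  have hprt : Tendsto pr atTop (𝓝 ((0 : ℂ), (0 : ℂ))) := tendsto_inv_and_log_div
  have hρlim : Tendsto (fun m => ψ (pr m)) atTop (𝓝 ρs) := hψlim.comp hprt
  have hsol : ∀ᶠ m in atTop, f (pr m, ψ (pr m)) = 0 := hprt.eventually hψsol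
  set x : ℕ → Fin 2 → ℂ := fun m =>
    ![2 * Real.pi * I * p * m + Real.log m + (ψ (pr m)).1,
      2 * Real.pi * I * p * m + Real.log m + (ψ (pr m)).2] with hx
  refine ⟨x, fun m => ψ (pr m), hρlim,
    fun m => by simp only [hx, Matrix.cons_val_zero, hP],
    fun m => by simp only [hx, Matrix.cons_val_one, Matrix.cons_val_zero, hP], ?_⟩
  filter_upwards [hsol, eventually_ge_atTop 1] with m hm hm1
  have hmpos : (0 : ℝ) < (m : ℝ) := by exact_mod_cast hm1
  have hmC : (m : ℂ) ≠ 0 := by exact_mod_cast (show m ≠ 0 by omega)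
  have hexpL : exp ((Real.log m : ℝ) : ℂ) = (m : ℂ) := by
    rw [← Complex.ofReal_exp, Real.exp_log hmpos]
    push_cast
    rfl
  have hexpP : exp (2 * Real.pi * I * p * m) = 1 := by
    have := Complex.exp_int_mul_two_pi_mul_I (p * m)
    rw [← this]; congr 1; push_cast; ring
  have hinv : (m : ℂ) * (1 / (m : ℂ)) = 1 := by field_simp
  have hs : (((1 / (m : ℝ) : ℝ)) : ℂ) = 1 / (m : ℂ) := by push_cast; rfl
  have hl : (((Real.log m / (m : ℝ) : ℝ)) : ℂ) = ((Real.log m : ℝ) : ℂ) * (1 / (m : ℂ)) := by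
    rw [Complex.ofReal_div]
    push_cast
    ring
  -- the two rescaled equations
  have heq : exp (ψ (pr m)).1 = P + exp (c + (r₀ : ℂ) * (ψ (pr m)).1 + r₁ * (ψ (pr m)).2) +
      ((Real.log m : ℝ) : ℂ) * (1 / (m : ℂ)) + 1 / (m : ℂ) * (ψ (pr m)).1 ∧
      exp (ψ (pr m)).2 = P + exp (c + (r₀ : ℂ) * (ψ (pr m)).1 + r₁ * (ψ (pr m)).2) +
      ((Real.log m : ℝ) : ℂ) * (1 / (m : ℂ)) + 1 / (m : ℂ) * (ψ (pr m)).2 := by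
    have hpr1 : (pr m).1 = 1 / (m : ℂ) := by simp only [hpr]; exact hs
    have hpr2 : (pr m).2 = ((Real.log m : ℝ) : ℂ) * (1 / (m : ℂ)) := by simp only [hpr]; exact hl
    simp only [hf, Prod.mk_eq_zero] at hm
    rw [hpr1, hpr2] at hm
    obtain ⟨hm0, hm1'⟩ := hm
    exact ⟨by linear_combination hm0, by linear_combination hm1'⟩
  obtain ⟨hq0, hq1⟩ := heq
  -- the hyperplane value
  have hlin : (∑ i, ((![r₀, 1 - r₀] : Fin 2 → ℝ) i : ℂ) * x m i) + c =
      2 * Real.pi * I * p * m + ((Real.log m : ℝ) : ℂ) +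
        (c + (r₀ : ℂ) * (ψ (pr m)).1 + r₁ * (ψ (pr m)).2) := by
    rw [Fin.sum_univ_two]
    simp only [hx, Matrix.cons_val_zero, Matrix.cons_val_one]
    rw [hr₁]
    push_cast
    ring
  have hGexp : exp (2 * Real.pi * I * p * m + ((Real.log m : ℝ) : ℂ) +
      (c + (r₀ : ℂ) * (ψ (pr m)).1 + r₁ * (ψ (pr m)).2)) =
      (m : ℂ) * exp (c + (r₀ : ℂ) * (ψ (pr m)).1 + r₁ * (ψ (pr m)).2) := by
    rw [Complex.exp_add (2 * Real.pi * I * p * m + ((Real.log m : ℝ) : ℂ)),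
      Complex.exp_add (2 * Real.pi * I * p * m), hexpP, one_mul, hexpL]
  have hx0exp : exp (2 * Real.pi * I * p * m + ((Real.log m : ℝ) : ℂ) + (ψ (pr m)).1) =
      (m : ℂ) * exp (ψ (pr m)).1 := by
    rw [Complex.exp_add (2 * Real.pi * I * p * m + ((Real.log m : ℝ) : ℂ)),
      Complex.exp_add (2 * Real.pi * I * p * m), hexpP, one_mul, hexpL]
  have hx1exp : exp (2 * Real.pi * I * p * m + ((Real.log m : ℝ) : ℂ) + (ψ (pr m)).2) =
      (m : ℂ) * exp (ψ (pr m)).2 := by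
    rw [Complex.exp_add (2 * Real.pi * I * p * m + ((Real.log m : ℝ) : ℂ)),
      Complex.exp_add (2 * Real.pi * I * p * m), hexpP, one_mul, hexpL]
  intro j
  rw [hlin, hGexp]
  fin_cases j
  · simp only [hx, Fin.zero_eta, Matrix.cons_val_zero]
    rw [hx0exp, hq0, hP]
    push_cast
    linear_combination (Complex.log ((m : ℕ) : ℂ) + (ψ (pr m)).1) * hinv
  · simp only [hx, Fin.mk_one, Matrix.cons_val_one, Matrix.cons_val_zero]
    rw [hx1exp, hq1, hP]
    push_cast
    linear_combination (Complex.log ((m : ℕ) : ℂ) + (ψ (pr m)).2) * hinv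

end Diagonal

end Summit.Schanuel.Schanuel.Theorems

end
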